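import Literature.NumberTheory.EllipticCurves.CyclotomicZpExtensionLayerProofs
import Literature.NumberTheory.GaloisRepresentations.ModNCyclotomicCharacter
import HarnessLib

/-!
# The cyclotomic `ℤ_p`-extension of `ℚ`, `p` odd: the image of the layer group `Gal(ℚ̄/ℚ_n)` under the
# mod-`p^{n+1}` cyclotomic character is `(p − 1)`-torsion — i.e. lies in `Δ = μ_{p−1} ⊂ (ℤ/p^{n+1})ˣ`
# (the converse companion of `CyclotomicZpExtensionLayerProofs`; proofs only, no definitions, no named facts)

Topic `NumberTheory/EllipticCurves` (next to `CyclotomicZpExtension.lean` / `CyclotomicZpExtensionLayerProofs.lean`).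
Seat `bsd-cm-prr-ty1` (cell `bsd-cm`; K-CUT-2 input (a), kernel part 2b). `CyclotomicZpExtensionLayerProofs` proved
`Gal(ℚ̄/ℚ(μ_{p^{n+1}})) ≤ Gal(ℚ̄/ℚ_n)` (`ℚ_n ⊂ ℚ(ζ_{p^{n+1}})`). Here the complementary half of Washington's
"`ℚ_n` is the fixed field of `Δ ≅ (ℤ/p)ˣ` in `ℚ(ζ_{p^{n+1}})`" [§13.1]: for `σ ∈ Gal(ℚ̄/ℚ_n)` the mod-`p^{n+1}`
cyclotomic character `χ^{(p^{n+1})}(σ) ∈ (ℤ/p^{n+1})ˣ` satisfies `χ^{(p^{n+1})}(σ)^{p−1} = 1`. Consequently every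
Dirichlet character mod `p^{n+1}` killing `Δ = {b : b^{p−1} = 1}` (a character of `Gal(ℚ_n/ℚ)`, cf.
`Kato2004/LayerCharacterCuspFactorProofs.lean`) kills `χ^{(p^{n+1})}(Gal(ℚ̄/ℚ_n))` — the hypothesis `hχ` of
`Kato2004.charSum_eq_zero_of_levelToLayer_eq_zero` (`Kato2004/ZetaBodyLayerValuesProofs.lean`).

## Statements

* `CyclotomicZp.norm_pow_sub_one_le_of_pow_dvd_ell` — for `p` odd and a unit `u` with `p^n ∣ ℓ(u)`
  (normalised logarithm `ℓ` of `CyclotomicZpExtension.lean`: `γ_cyc^{t ℓ(u)} = u^t`, `t = p − 1`):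
  `‖u^{p−1} − 1‖ ≤ ‖p^{n+1}‖`, by `‖γ_cyc^y − 1‖ = ‖y‖·‖p‖` (Serre, *Cours d'arithmétique* II.3.2).
* `CyclotomicZp.toZModPow_pow_eq_one_of_pow_dvd_ell` — the same as `u^{p−1} ≡ 1 (mod p^{n+1})`.
* `CyclotomicZp.modNCyclotomicCharacter_eq_toZModPow` — the mod-`p^{n+1}` cyclotomic character of `Γ_ℚ` IS the
  reduction of the `p`-adic one (both move a primitive `p^{n+1}`-th root of unity the same way).
* `CyclotomicZp.modNCyclotomicCharacter_pow_eq_one_of_mem_layerSubgroup_zpExtension` and, for EVERY cyclotomic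
  `κ : ZpExtension ℚ p` (a unit twist of `κ_cyc`, same layers),
  `ZpExtension.IsCyclotomic.modNCyclotomicCharacter_pow_eq_one_of_mem_layerSubgroup`:
  `σ ∈ κ.layerSubgroup n ⇒ χ^{(M)}(σ)^{p−1} = 1` for `M = p^{n+1}`;
  `ZpExtension.IsCyclotomic.dirichletCharacter_apply_eq_one_of_mem_layerSubgroup`: hence a Dirichlet character
  `χ` mod `M` with `χ(b) = 1` whenever `b^{p−1} = 1` satisfies `χ(χ^{(M)}(σ)) = 1` on `κ.layerSubgroup n`.

Only `p` odd (for `p = 2` the layer `ℚ_n` sits in `ℚ(μ_{2^{n+2}})` with `Δ = {±1}`; `-- TODO(general form)`).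

References: L. C. Washington, *Introduction to Cyclotomic Fields*, 2nd ed. (1997), §13.1 [Washington1997];
J.-P. Serre, *A Course in Arithmetic*, Ch. II §3.2 Prop. 8 [Serre1973]; tree: `CyclotomicZpExtension.lean`
(`ell`, `cycPow`, `zpExtension`, `oneAddPow`, `norm_oneAddPow_sub_one`), `CyclotomicZpExtensionLayerProofs.lean`,
`ZpExtensionUnitTwistProofs.lean` (`IsCyclotomic.exists_eq_unitTwist_holds`), `ModNCyclotomicCharacter.lean`
(`modNCyclotomicCharacter_spec`), `GaloisRep.lean` (`GaloisRep.cyclotomicCharacter_spec`).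
-/

set_option autoImplicit false

noncomputable section

open scoped NumberField
open Field
open Literature.NumberTheory.GaloisRepresentations
open Literature.NumberTheory.EllipticCurves Literature.NumberTheory.EllipticCurves.PadicOneUnits

namespace Literature.NumberTheory.EllipticCurves.CyclotomicZp

variable (p : ℕ) [Fact p.Prime]

omit [Fact p.Prime] in
/-- For odd `p` the cyclotomic exponent is `1` (`γ_cyc = 1 + p`) (local copy, as in
`CyclotomicZpExtensionLayerProofs`). [folklore] -/
private theorem cyclotomicExponent_of_ne_two (hp : p ≠ 2) : cyclotomicExponent p = 1 := if_neg hp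

/-- For odd `p` the torsion order `#μ(ℤ_p)` is `p − 1` (local copy). [folklore] -/
private theorem torsionOrder_of_ne_two (hp : p ≠ 2) : torsionOrder p = p - 1 := by
  rw [torsionOrder, cyclotomicExponent_of_ne_two p hp, pow_one, Nat.totient_prime (Fact.out : p.Prime)]

/-- **`‖u^{p−1} − 1‖ ≤ ‖p^{n+1}‖` when `p^n ∣ ℓ(u)`, `p` odd**: `u^{p−1} = γ_cyc^{(p−1)ℓ(u)}` and
`‖γ_cyc^y − 1‖ = ‖y‖·‖p‖ ≤ ‖p^n‖·‖p‖`. [cite: Serre1973, Ch. II §3.2 Prop. 8] -/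
theorem norm_pow_sub_one_le_of_pow_dvd_ell (hp : p ≠ 2) (u : ℤ_[p]ˣ) (n : ℕ)
    (h : (p : ℤ_[p]) ^ n ∣ ell p u) :
    ‖(u : ℤ_[p]) ^ (p - 1) - 1‖ ≤ ‖(p : ℤ_[p]) ^ (n + 1)‖ := by
  have hprime := (Fact.out : p.Prime)
  obtain ⟨w, hw⟩ := h
  -- `u^{p-1} = γ_cyc^{(p-1) ℓ(u)}`
  have h1 : (u : ℤ_[p]) ^ (p - 1) = cycPow p (torsionOrder p * ell p u) := by
    rw [cycPow_torsionOrder_mul_ell, torsionOrder_of_ne_two p hp]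
  have he : cyclotomicExponent p - 1 + 3 ≤ p * (cyclotomicExponent p - 1 + 1) := by
    rw [cyclotomicExponent_of_ne_two p hp]
    have := hprime.two_le
    omega
  have h2 : ‖cycPow p (torsionOrder p * ell p u) - 1‖ =
      ‖(torsionOrder p : ℤ_[p]) * ell p u‖ * ‖(p : ℤ_[p]) ^ (cyclotomicExponent p - 1 + 1)‖ :=
    norm_oneAddPow_sub_one (p := p) (cyclotomicExponent p - 1) he _
  rw [cyclotomicExponent_of_ne_two p hp, Nat.sub_self, zero_add, pow_one] at h2
  rw [h1, h2, hw, pow_succ, norm_mul, norm_mul, norm_mul]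
  have ht : ‖(torsionOrder p : ℤ_[p])‖ ≤ 1 := PadicInt.norm_le_one _
  have hw1 : ‖w‖ ≤ 1 := PadicInt.norm_le_one _
  have hpn : 0 ≤ ‖(p : ℤ_[p]) ^ n‖ := norm_nonneg _
  have hp0 : 0 ≤ ‖(p : ℤ_[p])‖ := norm_nonneg _
  calc ‖(torsionOrder p : ℤ_[p])‖ * (‖(p : ℤ_[p]) ^ n‖ * ‖w‖) * ‖(p : ℤ_[p])‖
      ≤ 1 * (‖(p : ℤ_[p]) ^ n‖ * 1) * ‖(p : ℤ_[p])‖ := by gcongr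
    _ = ‖(p : ℤ_[p]) ^ n‖ * ‖(p : ℤ_[p])‖ := by ring

/-- **`u^{p−1} ≡ 1 (mod p^{n+1})` when `p^n ∣ ℓ(u)`, `p` odd.** [cite: Serre1973, Ch. II §3.2 Prop. 8] -/
theorem toZModPow_pow_eq_one_of_pow_dvd_ell (hp : p ≠ 2) (u : ℤ_[p]ˣ) (n : ℕ)
    (h : (p : ℤ_[p]) ^ n ∣ ell p u) :
    PadicInt.toZModPow (n + 1) ((u : ℤ_[p]) ^ (p - 1)) = 1 := by
  have hle := norm_pow_sub_one_le_of_pow_dvd_ell p hp u n h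
  rw [PadicInt.norm_p_pow, PadicInt.norm_le_pow_iff_mem_span_pow, ← PadicInt.ker_toZModPow,
    RingHom.mem_ker, map_sub, map_one, sub_eq_zero] at hle
  exact hle

/-- **The mod-`p^k` cyclotomic character IS the reduction of the `p`-adic one**: for `σ ∈ Γ_ℚ`,
`χ^{(p^k)}(σ) = χ_p(σ) mod p^k` in `ℤ/p^k` (both are read off `σ ζ = ζ^{·}` for a primitive `p^k`-th root of unity
`ζ ∈ ℚ̄`; Serre: the `ℓ`-adic cyclotomic character is the inverse limit of the mod-`ℓ^k` ones).
[cite: SerreAbelianLadic1968, Ch. I §1.2] -/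
theorem modNCyclotomicCharacter_eq_toZModPow (k : ℕ) [NeZero (p ^ k)] (σ : absoluteGaloisGroup ℚ) :
    ((modNCyclotomicCharacter ℚ (p ^ k) σ : (ZMod (p ^ k))ˣ) : ZMod (p ^ k)) =
      (GaloisRep.cyclotomicCharacter ℚ p σ).val.toZModPow k := by
  have hprime := (Fact.out : p.Prime)
  obtain ⟨ζ, hζ⟩ := HasEnoughRootsOfUnity.exists_primitiveRoot (AlgebraicClosure ℚ) (p ^ k)
  have h1 := GaloisRep.cyclotomicCharacter_spec ℚ p (k := k) σ ζ hζ.pow_eq_one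
  have h2 := modNCyclotomicCharacter_spec ℚ (p ^ k) σ ζ hζ.pow_eq_one
  rw [h2] at h1
  -- `ζ^a = ζ^b` with `a, b < p^k`
  have hlt : ∀ x : ZMod (p ^ k), x.val < p ^ k := fun x => ZMod.val_lt x
  have hab := hζ.pow_inj (hlt _) (hlt _) h1
  exact ZMod.val_injective _ hab

/-- **`σ ∈ Gal(ℚ̄/ℚ_n)` ⇒ `χ^{(p^{n+1})}(σ)^{p−1} = 1`** for the normalised cyclotomic `ℤ_p`-extension `κ_cyc = ℓ ∘ χ_p`,
`p` odd: `σ ∈ κ_cyc⁻¹(p^n ℤ_p)` means `p^n ∣ ℓ(χ_p σ)`, so `χ_p(σ)^{p−1} ≡ 1 (mod p^{n+1})`. (Washington §13.1: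
`Gal(ℚ(ζ_{p^{n+1}})/ℚ_n) = Δ`.) [cite: Washington1997, §13.1] -/
theorem modNCyclotomicCharacter_pow_eq_one_of_mem_layerSubgroup_zpExtension (hp : p ≠ 2) (n : ℕ)
    [NeZero (p ^ (n + 1))] {σ : absoluteGaloisGroup ℚ} (hσ : σ ∈ (zpExtension p).layerSubgroup n) :
    (modNCyclotomicCharacter ℚ (p ^ (n + 1)) σ) ^ (p - 1) = 1 := by
  rw [ZpExtension.mem_layerSubgroup, zpExtension_apply, toAdd_ofAdd] at hσ
  have h := toZModPow_pow_eq_one_of_pow_dvd_ell p hp (GaloisRep.cyclotomicCharacter ℚ p σ) n hσ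
  ext
  rw [Units.val_pow_eq_pow_val, modNCyclotomicCharacter_eq_toZModPow, Units.val_one, ← map_pow]
  exact h

end Literature.NumberTheory.EllipticCurves.CyclotomicZp

namespace Literature.NumberTheory.EllipticCurves.ZpExtension

variable {p : ℕ} [Fact p.Prime]

/-- **`σ ∈ Gal(ℚ̄/ℚ_n)` ⇒ `χ^{(M)}(σ)^{p−1} = 1`, `M = p^{n+1}`, for EVERY cyclotomic `ℤ_p`-extension `κ` of `ℚ`, `p`
odd** (`κ` is a unit twist of `κ_cyc`, with the same layers). [cite: Washington1997, §13.1] -/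
theorem IsCyclotomic.modNCyclotomicCharacter_pow_eq_one_of_mem_layerSubgroup {κ : ZpExtension ℚ p}
    (hκ : κ.IsCyclotomic) (hp : p ≠ 2) (n : ℕ) {M : ℕ} [NeZero M] (hM : M = p ^ (n + 1))
    {σ : absoluteGaloisGroup ℚ} (hσ : σ ∈ κ.layerSubgroup n) :
    (modNCyclotomicCharacter ℚ M σ) ^ (p - 1) = 1 := by
  subst hM
  obtain ⟨u, rfl⟩ := IsCyclotomic.exists_eq_unitTwist_holds
    (CyclotomicZp.isCyclotomic_zpExtension p) hκ
  rw [layerSubgroup_unitTwist] at hσ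
  exact CyclotomicZp.modNCyclotomicCharacter_pow_eq_one_of_mem_layerSubgroup_zpExtension p hp n hσ

/-- **A Dirichlet character mod `M = p^{n+1}` that kills `Δ = {b : b^{p−1} = 1}` kills the image of `Gal(ℚ̄/ℚ_n)`**
under the mod-`M` cyclotomic character (every cyclotomic `κ`, `p` odd) — the hypothesis of
`Kato2004.charSum_eq_zero_of_levelToLayer_eq_zero`. [cite: Washington1997, §13.1] -/
theorem IsCyclotomic.dirichletCharacter_apply_eq_one_of_mem_layerSubgroup {κ : ZpExtension ℚ p}
    (hκ : κ.IsCyclotomic) (hp : p ≠ 2) (n : ℕ) {M : ℕ} [NeZero M] (hM : M = p ^ (n + 1))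
    {R : Type*} [CommMonoidWithZero R] (χ : DirichletCharacter R M)
    (hχ : ∀ b : (ZMod M)ˣ, b ^ (p - 1) = 1 → χ b = 1)
    {σ : absoluteGaloisGroup ℚ} (hσ : σ ∈ κ.layerSubgroup n) :
    χ ((modNCyclotomicCharacter ℚ M σ : (ZMod M)ˣ) : ZMod M) = 1 :=
  hχ _ (hκ.modNCyclotomicCharacter_pow_eq_one_of_mem_layerSubgroup hp n hM hσ)

-- TODO(general form): `p = 2` (`ℚ_n ⊂ ℚ(μ_{2^{n+2}})`, `Δ = {±1}`), and a general base field `K`.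

end Literature.NumberTheory.EllipticCurves.ZpExtension

end
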